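import Summits.CriticalPhenomena.PercolationContinuityZ3.Theorems.PercNearOneGluingNoHeavyQuantSliceLawSWNumerics
import Summits.CriticalPhenomena.PercolationContinuityZ3.Theorems.PercNearOneGluingNoHeavyQuantSliceSingleLayerLaws
import HarnessLib

/-!
# QUANT lane R8, T-DEC: towards `LawDec.SliceLawSW` — part 5: THE CORE CASE (light pair, `h` a true mid of the slice, `h′ = h`) is DEC with an
# explicit transfer

builds on p205010 (kernel theorem, internal audit signed; external expert review pending)

Support file (`--supports stmt-CriticalPhenomena-4575`), QUANT lane typer seat prim-quant-stmt (gen 24), rung R8 of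
`run/shared/lean/prim/quant/LADDER.md`.  Theorems only, standard axioms, no sorries.  Parts 1–4: `…QuantSliceLawSWFlow` (`swLawAt_decAtT_of_flow`),
`…QuantSliceLawSWPoly`, `…QuantSliceLawSWCells`, `…QuantSliceLawSWNumerics` (`sw_numerics_H/L`); census-2 g55's `…QuantSliceSingleLayerLaws`
(`LawDec.swLaw`, `LawDec.SliceLawSW`).

* **`LawDec.sliceLawSW_core`** — `0 < x < 1`, `x ≤ g < 1`, `1 ≤ a`, a low `l` (`l + a ≤ j′`, `2l < T`), a window absorber `h` (`j′ < h + a`, `h ≤ j′`,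
  `h ≤ M`, `T ≤ 2h`, `T < l + h`) whose pair is LIGHT (`(T − 2l)/(h − l) < x`) and whose position is still self-sufficient at the raised target
  (`T + ag ≤ 2h`): there is a transfer `0 ≤ t(1−g) ≤ γg` (`γ = pairGate x T l h = x² + (1−x)ρ`) with
  `DECAtT x (T + ag) j′ (M + a) (swLaw γ g t l h h a)`.  Proof: the numerics of part 4 in the coordinates `ρ = (T−2l)/(h−l)`, `D = h − l`,
  `C = ρD + ag = T + ag − 2l`, the usage rates identified with their closed forms (`usage_eq_light'/heavy'`, typer g23), then the flow theorem of part 1.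
Part 6 (`…QuantSliceLawSWHolds`) adds the heavy pairs (`t = 0`, BLOB-DEC(2)), the band-like `h` (`t = 0`, `bandTwoBlobDEC_holds`) and the positions `h′ > h`
(`FlowAtT.shift_absorber_up`), proving `SliceLawSW`.

[this work]; memo SINGLE-LAYER-G55 §3b–§3c (census-2 g55).  Nothing here is cited as a published result.  The gluing rows served
[cite: KozmaNitzan2024, Conjecture 3 (p. 15)]; product measure [cite: Grimmett1999, §1.3 p. 10].
-/

noncomputable section

namespace Summit.CriticalPhenomena.PercolationContinuityZ3.Theorems

namespace Quant

open Finset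

namespace LawDec

/-- a light pair's minimal gate is the discounted form: `ρ ≤ x ⟹ pairGate = x² + (1−x)ρ`. [this work] -/
theorem pairGate_eq_light (x T : ℝ) (l h : ℕ) (hx0 : 0 ≤ x) (hρ : (T - 2 * (l : ℝ)) / ((h : ℝ) - l) ≤ x) :
    pairGate x T l h = x ^ 2 + (1 - x) * ((T - 2 * (l : ℝ)) / ((h : ℝ) - l)) := by
  unfold pairGate
  refine max_eq_right ?_
  nlinarith [mul_nonneg hx0 (sub_nonneg.2 hρ)]

set_option maxHeartbeats 1600000 in
/-- **THE CORE CASE OF `SliceLawSW`** (light pair, `h` self-sufficient at `T + ag`, `h′ = h`). [this work] -/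
theorem sliceLawSW_core (x g T : ℝ) (M a j' l h : ℕ) (hx0 : 0 < x) (hx1 : x < 1) (hxg : x ≤ g) (hg1 : g < 1) (ha : 1 ≤ a)
    (hla : l + a ≤ j') (hlow : 2 * (l : ℝ) < T) (hwin : j' < h + a) (hhj : h ≤ j') (hhM : h ≤ M) (hT2 : T ≤ 2 * (h : ℝ))
    (hcomp : T < (l : ℝ) + h) (hlight : (T - 2 * (l : ℝ)) / ((h : ℝ) - l) < x) (hWmid : T + (a : ℝ) * g ≤ 2 * (h : ℝ)) :
    ∃ t : ℝ, 0 ≤ t ∧ t * (1 - g) ≤ pairGate x T l h * g ∧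
      DECAtT x (T + (a : ℝ) * g) j' (M + a) (swLaw (pairGate x T l h) g t l h h a) := by
  -- coordinates
  have h1x : 0 < 1 - x := sub_pos.2 hx1
  have hg0 : 0 < g := hx0.trans_le hxg
  have ha0 : (0 : ℝ) < a := by exact_mod_cast Nat.lt_of_lt_of_le Nat.zero_lt_one ha
  have hlh' : (l : ℝ) < h := by linarith
  have hlh : l < h := by exact_mod_cast hlh'
  obtain ⟨D, hD⟩ : ∃ D : ℝ, D = (h : ℝ) - l := ⟨_, rfl⟩
  have hD0 : 0 < D := by rw [hD]; linarith
  obtain ⟨ρ, hρ⟩ : ∃ ρ : ℝ, ρ = (T - 2 * (l : ℝ)) / D := ⟨_, rfl⟩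
  have hρD : ρ * D = T - 2 * (l : ℝ) := by rw [hρ]; field_simp
  have hr0 : 0 < ρ := by rw [hρ]; exact div_pos (by linarith) hD0
  have hrx : ρ < x := by rw [hρ, hD]; exact hlight
  obtain ⟨T', hT'⟩ : ∃ T' : ℝ, T' = T + (a : ℝ) * g := ⟨_, rfl⟩
  have hC : ρ * D + (a : ℝ) * g = T' - 2 * (l : ℝ) := by rw [hρD, hT']; ring
  have hγ : pairGate x T l h = x ^ 2 + (1 - x) * ρ := by rw [hρ, hD]; exact pairGate_eq_light x T l h hx0.le hlight.le
  have hgam : 0 < x ^ 2 + (1 - x) * ρ := by nlinarith [mul_pos h1x hr0, pow_pos hx0 2]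
  have hgam1 : x ^ 2 + (1 - x) * ρ < 1 := by nlinarith [mul_lt_mul_of_pos_left hrx h1x]
  have hWmid' : T' ≤ 2 * (h : ℝ) := by rw [hT']; exact hWmid
  have hmidW : ρ * D + (a : ℝ) * g ≤ 2 * D := by rw [hC, hD]; linarith
  have hxD : x * D < D := by nlinarith
  have hρxD : ρ * D < x * D := mul_lt_mul_of_pos_right hrx hD0
  have hag1 : (a : ℝ) * g ≤ a := by nlinarith
  have hxag : x * (a : ℝ) ≤ a * g := by nlinarith
  have hρa : ρ * (a : ℝ) ≤ x * a := (mul_le_mul_of_nonneg_right hrx.le ha0.le)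
  have hCDa : ρ * D + (a : ℝ) * g < D + a := by linarith
  have hag0 : 0 ≤ (a : ℝ) * g := mul_nonneg ha0.le hg0.le
  have hlowT' : 2 * (l : ℝ) < T' := by rw [hT']; linarith
  -- the numerics, on either side of the pair `(l, h)` at `T′`
  have main : ∃ t F₁ F₂ F₃ : ℝ, 0 ≤ t ∧ t * (1 - g) ≤ (x ^ 2 + (1 - x) * ρ) * g ∧
      0 ≤ F₁ ∧ F₁ ≤ (1 - (x ^ 2 + (1 - x) * ρ)) * g ∧ (0 < F₁ → 2 * (a : ℝ) < ρ * D + a * g) ∧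
      0 ≤ F₂ ∧ (0 < F₂ → ρ * D + a * g < D) ∧
      0 ≤ F₃ ∧ (0 < F₃ → ρ * D + a * g ≤ 2 * a ∧ ρ * D + a * g < a) ∧
      F₂ + F₃ ≤ (1 - (x ^ 2 + (1 - x) * ρ)) * (1 - g) ∧
      usage x T' j' (l + a) h * F₁ + usage x T' j' l h * F₂ ≤ ((x ^ 2 + (1 - x) * ρ) + t) * (1 - g) ∧
      usage x T' j' l (l + a) * F₃ ≤ (1 - (x ^ 2 + (1 - x) * ρ)) * g ∧
      x / (1 - x) * ((if 2 * (a : ℝ) < ρ * D + a * g then (1 - (x ^ 2 + (1 - x) * ρ)) * g - F₁ else 0)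
          + ((1 - (x ^ 2 + (1 - x) * ρ)) * (1 - g) - F₂ - F₃))
        ≤ (x ^ 2 + (1 - x) * ρ) * g - t * (1 - g) := by
    -- the anti-diagonal pair `(l+a, h)` in closed form (only needed when `l + a` is low)
    have hu1 : ∀ F₁ : ℝ, 0 ≤ F₁ → (0 < F₁ → 2 * (a : ℝ) < ρ * D + a * g) →
        usage x T' j' (l + a) h * F₁
          = (x ^ 2 * (D - a) + (1 - x) * ((ρ * D + a * g) - 2 * a)) / ((1 - x) * ((1 + x) * (D - a) - ((ρ * D + a * g) - 2 * a))) * F₁ := by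
      intro F₁ hF1 hF1c
      rcases hF1.eq_or_lt with hz | hpos
      · rw [← hz, mul_zero, mul_zero]
      · have hdeep := hF1c hpos
        have hDa : (a : ℝ) < D := by linarith
        have hcast : (((l + a : ℕ) : ℝ)) = (l : ℝ) + a := by push_cast; ring
        have hxDa : 0 < x * (D - a) := mul_pos hx0 (sub_pos.2 hDa)
        have hlowa : 2 * (((l + a : ℕ) : ℝ)) < T' := by rw [hcast]; linarith
        have hcompa : T' < ((l + a : ℕ) : ℝ) + h := by rw [hcast]; linarith
        have hside : T' - 2 * (((l + a : ℕ) : ℝ)) ≤ x * ((h : ℝ) - ((l + a : ℕ) : ℝ)) := by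
          rw [hcast]
          have h2 : x * ((h : ℝ) - ((l : ℝ) + a)) = x * D - x * a := by rw [hD]; ring
          rw [h2]; linarith
        rw [usage_eq_light' x T' j' (l + a) h hx0 hx1 hhj hlowa hcompa hside]
        congr 1
        have hden1 : (1 - x) * ((1 - x) * (((l + a : ℕ) : ℝ)) + (1 + x) * (h : ℝ) - T') ≠ 0 := by
          apply mul_ne_zero h1x.ne'
          rw [hcast]
          have h2 : (1 - x) * ((l : ℝ) + a) + (1 + x) * (h : ℝ) - T' = ((l : ℝ) + a + h - T') + x * (D - a) := by rw [hD]; ring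
          rw [h2]; linarith
        have hden2 : (1 - x) * ((1 + x) * (D - a) - ((ρ * D + a * g) - 2 * a)) ≠ 0 := by
          apply mul_ne_zero h1x.ne'
          have h2 : (1 + x) * (D - a) - ((ρ * D + a * g) - 2 * a) = (D + a - (ρ * D + a * g)) + x * (D - a) := by ring
          rw [h2]; linarith
        rw [div_eq_div_iff hden1 hden2, hcast, hC, hD]
        ring
    -- the pair `(l, l+a)` in closed form (only needed when `l + a` is a compatible absorber)
    have hu3 : ∀ F₃ : ℝ, 0 ≤ F₃ → (0 < F₃ → ρ * D + a * g ≤ 2 * a ∧ ρ * D + a * g < a) →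
        usage x T' j' l (l + a) * F₃ = (ρ * D + a * g) / (a - (ρ * D + a * g)) * F₃ := by
      intro F₃ hF3 hF3c
      rcases hF3.eq_or_lt with hz | hpos
      · rw [← hz, mul_zero, mul_zero]
      · obtain ⟨-, hCa⟩ := hF3c hpos
        have hcast : (((l + a : ℕ) : ℝ)) = (l : ℝ) + a := by push_cast; ring
        have hcomp3 : T' < (l : ℝ) + ((l + a : ℕ) : ℝ) := by rw [hcast]; linarith
        have hside3 : x * ((((l + a : ℕ) : ℝ)) - l) ≤ T' - 2 * (l : ℝ) := by
          rw [hcast]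
          have h2 : x * ((l : ℝ) + a - l) = x * a := by ring
          rw [h2]; linarith
        have hlow' : 2 * (l : ℝ) < T' := hlowT'
        rw [usage_eq_heavy' x T' j' l (l + a) hx0 hx1 hla hlow' hcomp3 hside3]
        congr 1
        have hden1 : (l : ℝ) + ((l + a : ℕ) : ℝ) - T' ≠ 0 := by rw [hcast]; linarith
        have hden2 : (a : ℝ) - (ρ * D + a * g) ≠ 0 := by linarith
        rw [div_eq_div_iff hden1 hden2, hcast, hC]
        ring
    by_cases hsideH : x * D ≤ ρ * D + a * g
    · obtain ⟨t, F₁, F₂, F₃, ht0, ht, hF1, hF1', hF1c, hF2, hF2c, hF3, hF3c, hR0, hmid, hmid1, htop⟩ :=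
        sw_numerics_H x ρ g a D hx0 hx1 hr0 hrx hxg hg1 ha0 hD0 hmidW hsideH
      -- the pair `(l, h)` is heavy at `T′`
      have hu2 : usage x T' j' l h * F₂ = (ρ * D + a * g) / (D - (ρ * D + a * g)) * F₂ := by
        rcases hF2.eq_or_lt with hz | hpos
        · rw [← hz, mul_zero, mul_zero]
        · have hCD := hF2c hpos
          have hcomp2 : T' < (l : ℝ) + h := by linarith
          have hside2 : x * ((h : ℝ) - l) ≤ T' - 2 * (l : ℝ) := by rw [← hC, ← hD]; exact hsideH
          have hlow' : 2 * (l : ℝ) < T' := hlowT'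
          rw [usage_eq_heavy' x T' j' l h hx0 hx1 hhj hlow' hcomp2 hside2]
          congr 1
          have hden1 : (l : ℝ) + h - T' ≠ 0 := by apply ne_of_gt; linarith
          have hden2 : D - (ρ * D + a * g) ≠ 0 := by apply ne_of_gt; linarith
          rw [div_eq_div_iff hden1 hden2, hC, hD]
          ring
      refine ⟨t, F₁, F₂, F₃, ht0, ht, hF1, hF1', hF1c, hF2, hF2c, hF3, hF3c, hR0, ?_, ?_, htop⟩
      · rw [hu1 F₁ hF1 hF1c, hu2]; exact hmid
      · rw [hu3 F₃ hF3 hF3c]; exact hmid1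
    · push Not at hsideH
      obtain ⟨t, F₁, F₂, F₃, ht0, ht, hF1, hF1', hF1c, hF2, hF2c, hF3, hF3c, hR0, hmid, hmid1, htop⟩ :=
        sw_numerics_L x ρ g a D hx0 hx1 hr0 hrx hxg hg1 ha0 hD0 hmidW hsideH.le
      -- the pair `(l, h)` is light at `T′`
      have hu2 : usage x T' j' l h * F₂
          = (x ^ 2 * D + (1 - x) * (ρ * D + a * g)) / ((1 - x) * ((1 + x) * D - (ρ * D + a * g))) * F₂ := by
        rcases hF2.eq_or_lt with hz | hpos
        · rw [← hz, mul_zero, mul_zero]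
        · have hCD := hF2c hpos
          have hcomp2 : T' < (l : ℝ) + h := by linarith
          have hside2 : T' - 2 * (l : ℝ) ≤ x * ((h : ℝ) - l) := by rw [← hC, ← hD]; exact hsideH.le
          have hlow' : 2 * (l : ℝ) < T' := hlowT'
          have hxD0 : 0 < x * D := mul_pos hx0 hD0
          rw [usage_eq_light' x T' j' l h hx0 hx1 hhj hlow' hcomp2 hside2]
          congr 1
          have hden1 : (1 - x) * ((1 - x) * (l : ℝ) + (1 + x) * (h : ℝ) - T') ≠ 0 := by
            apply mul_ne_zero h1x.ne'
            have h2 : (1 - x) * (l : ℝ) + (1 + x) * (h : ℝ) - T' = ((l : ℝ) + h - T') + x * D := by rw [hD]; ring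
            rw [h2]; linarith
          have hden2 : (1 - x) * ((1 + x) * D - (ρ * D + a * g)) ≠ 0 := by
            apply mul_ne_zero h1x.ne'
            have h2 : (1 + x) * D - (ρ * D + a * g) = (D - (ρ * D + a * g)) + x * D := by ring
            rw [h2]; linarith
          rw [div_eq_div_iff hden1 hden2, hC, hD]
          ring
      refine ⟨t, F₁, F₂, F₃, ht0, ht, hF1, hF1', hF1c, hF2, hF2c, hF3, hF3c, hR0, ?_, ?_, htop⟩
      · rw [hu1 F₁ hF1 hF1c, hu2]; exact hmid
      · rw [hu3 F₃ hF3 hF3c]; exact hmid1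
  obtain ⟨t, F₁, F₂, F₃, ht0, ht, hF1, hF1', hF1c, hF2, hF2c, hF3, hF3c, hR0, hmid, hmid1, htop⟩ := main
  refine ⟨t, ht0, by rw [hγ]; exact ht, ?_⟩
  -- the transferred law with `h′ = h` is the four-position law of the flow theorem
  have e : swLaw (pairGate x T l h) g t l h h a = fun p => (1 - (x ^ 2 + (1 - x) * ρ)) * (1 - g) * (if p = l then (1:ℝ) else 0)
      + (1 - (x ^ 2 + (1 - x) * ρ)) * g * (if p = l + a then (1:ℝ) else 0)
      + ((x ^ 2 + (1 - x) * ρ) + t) * (1 - g) * (if p = h then (1:ℝ) else 0)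
      + ((x ^ 2 + (1 - x) * ρ) * g - t * (1 - g)) * (if p = h + a then (1:ℝ) else 0) := by
    funext p; simp only [swLaw, hγ]; ring
  rw [e, ← hT']
  refine swLawAt_decAtT_of_flow x (x ^ 2 + (1 - x) * ρ) g T' t F₁ F₂ F₃ l h a j' M hx0 hx1 hgam.le hgam1.le hg0.le hg1.le ht0 ht
    hlh hla hhj hwin hhM hlowT' hWmid' hF1 hF1' ?_ hF2 ?_ hF3 ?_ hR0 hmid hmid1 ?_
  · intro hpos
    have hdeep := hF1c hpos
    exact ⟨by linarith, by linarith⟩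
  · intro hpos
    have hCD := hF2c hpos
    linarith
  · intro hpos
    obtain ⟨hsh, hCa⟩ := hF3c hpos
    exact ⟨by linarith, by linarith⟩
  · -- the deepness test of the flow theorem is the numerics' test
    by_cases hdeep : 2 * (a : ℝ) < ρ * D + a * g
    · rw [if_pos hdeep] at htop
      rw [if_pos (show 2 * ((l : ℝ) + a) < T' by linarith)]
      exact htop
    · rw [if_neg hdeep] at htop
      rw [if_neg (show ¬ (2 * ((l : ℝ) + a) < T') by intro h2; exact hdeep (by linarith))]
      exact htop

end LawDec

end Quant

end Summit.CriticalPhenomena.PercolationContinuityZ3.Theorems
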